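import Literature.MathematicalPhysics.QuantumFieldTheory.Balaban1983to89.B9B8KnitNeumannCoreReal
import Literature.MathematicalPhysics.QuantumFieldTheory.Balaban1983to89.B9B8KnitLandauProjection
import Literature.MathematicalPhysics.QuantumFieldTheory.Balaban1983to89.B9Eq327GreenZdHermPer

/-!
# `Balaban1983to89.B9B8KnitNeumannJunction` — the (B)-line bond junction, file 7c: dag-n06's PERIODIC GREEN'S FUNCTION `G_𝔤^per = gopZdHPer` OBEYS
# [4] Thm 3.3's THREE GLOBAL ENTRIES (constant `2B₀`) whenever def-Y's `G(U) = Δ_a(U)⁻¹` obeys them (constant `B₀`) and the knit operator is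
# `(c_fη)²`-close to def-Y's: `|Δ_a(U)a − (c_fη)²·(Δ_knit a♯)♭|₍₋₃₎ ≤ ε|a|₍₋₁₎`, `2εB₀ ≤ 1` — RULING #10 road (d) ASSEMBLED, the closeness displayed

statement-level skeleton of published theorems with citation tags; proofs where landed; nothing here is a claim about the
Yang–Mills mass gap

Sub-row G-B8-T2S (unit `lit-balaban-t2s-1`, gen 6), lit-balaban RULING #10 (planner lead g32, 2026-08-28): the Neumann junction.  dag-n06's periodic
Green's function of a letter record `o : OpsZd` at period `P₀` is `gopZdHPer η o P₀ U₀ = (Δ_knit↾E_𝔤^per(P₀))⁻¹ ∘ restrict`, `Δ_knit = deltaAOf η o U₀`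
(`B9Eq327GreenZdHermPer`), meaningful in the regime `RegularAtHPer` (bijectivity on the periodic Hermitian carrier).  def-Y's `Δ_a(U) = deltaAY i parS
parB Gp U` acts on the member's box bond functions; files 1–4 transport between the two carriers (`a♯ = liftBd i a`, `A♭ = descBd i A`, unit `c_fη`).
THIS FILE proves: if `Δ_knit` is real-linear (`LinearOnDomAt … univ`) and preserves `E_𝔤^per(P₀)` (`PerPreservingAt`) — both dag-n06-b theorems for the
genuine torus record (`linearOnDomAt_opsAllZdPer_univ`, `perPreservingAt_opsAllZdPer`) —, if `Δ_a(U)` (`U = bgY i U₀`) is invertible with the three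
(3.47)_{γ=−3} members at `B₀` (p38's M5.7 endpoint, r05's B-LINE 2 shapes), and if THE JUNCTION CLOSENESS `|Δ_a(U)a − (c_fη)²·(Δ_knit a♯)♭|₍₋₃₎ ≤ ε|a|₍₋₁₎`
holds with `2εB₀ ≤ 1` (OUR READING; files 5–6 are to supply it from the two curvature-smallness letters and the averaging closeness, the `D*D` and
Landau sectors agreeing exactly by files 1, 4), THEN `RegularAtHPer η o P₀ U₀` holds and, for every periodic Hermitian `J`, `G_𝔤^per J` obeys the three
global entries IN THE KNIT'S CURRENCY with constant `2B₀`: `|GJ|₍₋₁₎`, `|∇_{U₀}GJ|₍₋₂₎`, `|Δ_{U₀}GJ|₍₋₃₎ ≤ 2B₀·|J|₍₋₃₎` (`B8ScaledSupNorm.msup ∕ bondNorm` at the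
torus member `(ℓ+1, n, η)`, `Ω_j = ℤ^{d+1}`) — the three clauses of dag-n06-b's binder `B9SupplySockB9P3ZdPer.GlobAtIPer` at one background.
Print: [4] Thm 3.3 p. 399, (3.47) p. 398, (3.26)–(3.27) p. 395; [B8] (1.58)–(1.59) p. 86, p. 77 («Ω_j = T_η»).

WHAT IS PROVED (kernel, 0 sorry, theorems only).
* §1 bookkeeping: `descBd_add`, `descBd_smul`, `liftBd_zero`, `wNormBY_real_smul` (`|r•Ψ|₍α₎ = |r|·|Ψ|₍α₎`), `norm_descBd_le_pi`, `norm_apply_le_pi_descBd` (a periodic field is bounded by the sup of its box restriction).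
* §2 ★★ `regularAtHPer_of_isUnit_box` — `Δ_knit` real-linear + carrier-preserving + `(c_fη)²(Δ_knit ·♯)♭ = Δ_a(U) − E` with `Δ_a(U) − E` invertible on the box
  ⟹ `RegularAtHPer` (injective on the finite-dimensional carrier).
* §3 ★★★ `gopZdHPer_three_members` — the assembled junction described above.

HONEST SCOPE.  Assembly of files 1, 3, 7a–7b with dag-n06's periodic Green's-function API; the closeness `hE` and def-Y's three members are DISPLAYED
hypotheses (files 5–6 resp. p38's M5.7 supply them); no estimate of [4]∕[B8] is proved here; count-neutral; nothing continuum ∕ mass gap ∕ Clay — the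
Yang–Mills mass gap is NOT proved by any of this.  No `sorry`, no `def`, no `… : Prop` fact, no `instance`, no `notation`.  NEW file.
-/

noncomputable section

namespace Literature.MathematicalPhysics.QuantumFieldTheory.Balaban1983to89.B9B8KnitNeumannJunction

open scoped BigOperators
open Node00
open B7Prop1Explicit renaming Site → LSite
open B7Prop1Explicit (e)
open B12Ineq417Flat (shiftCfg)
open B6KLevelCensusIndexV1 (KIdx)
open B6GlobalChartV1 (PV)
open B8ScaledSupNorm (weight msup bondNorm Bdd)
open B8Ineq132 (covDerivFwd)
open B8Eq138LandauZd (covLap)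
open B8Ineq159AtLettersY (wNormBY_nonneg)
open B9B8KnitBondTransfer (descBd liftBd descBd_apply liftBd_apply descBd_liftBd liftBd_descBd liftBd_periodic cdB_transl lapB_transl)
open B9B8KnitNormsTransfer (weight_level_pos norm_liftBd_le norm_liftBd_le_of_wNormBY_le wNormBY_descBd_le msup_le_weight_top_mul bdd_of_forall_norm_le
  weight_top_mul_norm_le_bondNorm_univ bondNorm_le_weight_top_mul weight_defY_eq_mul_weight_knit)
open B9B8KnitNeumannCore (wNormBY_eq_weight_mul_norm)
open B9B8KnitNeumannCoreReal (GAY_sub_three_members_real)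
open B9B8KnitLandauProjection (apply_add_period_of_isPeriodic shiftCfg_eq_of_isPeriodic)
open B9B8CarrierDictionary (liftCfg)
open B8Thm2TorusLettersPerOfKnit (bgY liftCfg_bgY)
open B9SupplySockB9P3ZdLetters (OpsZd deltaAOf)
open B9Eq327GreenZd (LinearOnDomAt)
open B9Eq327GreenZdHermPer (domSubHPer mem_domSubHPer_iff mem_domSub_univ finiteDimensional_domSubHPer RegularAtHPer PerPreservingAt gopZdHPer
  gopZdHPer_apply_eq_of_regularAtHPer)
open T4TermwiseTorus (IsPeriodic)

variable {d ℓ : ℕ} {hd : 1 ≤ d + 1} {hL : Odd (ℓ + 1) ∧ 1 < ℓ + 1} {b₀ b₁ : ℝ}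
variable {𝔸 : Type} [CStarAlgebra 𝔸]
variable (i : KIdx d ℓ hd hL b₀ b₁) {n : ℕ}

/-! ## §1 Bookkeeping -/

/-- `(A + B)♭ = A♭ + B♭`. [cite: Balaban1985RegularSpaces, (1.3) p.77, bookkeeping] -/
theorem descBd_add (A B : LSite (d + 1) → Fin (d + 1) → 𝔸) : descBd i (A + B) = descBd i A + descBd i B := rfl

/-- `(r•A)♭ = r•A♭`. [cite: Balaban1985RegularSpaces, (1.3) p.77, bookkeeping] -/
theorem descBd_smul (r : ℝ) (A : LSite (d + 1) → Fin (d + 1) → 𝔸) : descBd i (r • A) = r • descBd i A := rfl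

/-- `0♯ = 0`. [cite: Balaban1985RegularSpaces, (1.3) p.77, bookkeeping] -/
theorem liftBd_zero : liftBd i (0 : FBondY i → 𝔸) = 0 := rfl

/-- `|r•Ψ|₍α₎ = |r|·|Ψ|₍α₎` at a constant-level member. [cite: Balaban1985BackgroundPropagators, (3.41) p.397, bookkeeping] -/
theorem wNormBY_real_smul (hlev : ∀ z : SiteY i, levY i z = n) (α r : ℝ) (Ψ : FBondY i → 𝔸) :
    wNormBY i α (r • Ψ) = |r| * wNormBY i α Ψ := by
  rw [wNormBY_eq_weight_mul_norm i hlev, wNormBY_eq_weight_mul_norm i hlev, norm_smul, Real.norm_eq_abs]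
  ring

/-- `‖J♭ b‖ ≤ ‖J♭‖` (sup norm of the finite product of the member's box bonds). [cite: Balaban1985RegularSpaces, p.77 («Ω_j = T_η»), bookkeeping] -/
theorem norm_descBd_le_pi (J : LSite (d + 1) → Fin (d + 1) → 𝔸) (b : FBondY i) : ‖descBd i J b‖ ≤ ‖descBd i J‖ := norm_le_pi_norm _ b

/-- a `P₀`-periodic bond field is bounded by the sup norm of its box restriction: `‖J(z, κ)‖ ≤ ‖J♭‖`. [cite: Balaban1985RegularSpaces, p.77 («Ω_j = T_η»), bookkeeping] -/
theorem norm_apply_le_pi_descBd {J : LSite (d + 1) → Fin (d + 1) → 𝔸} (hJ : IsPeriodic ((PV d ℓ i.m i.K hd hL).sitesPerDir 0) J)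
    (z : LSite (d + 1)) (κ : Fin (d + 1)) : ‖J z κ‖ ≤ ‖descBd i J‖ := by
  have h := norm_liftBd_le i (Ψ := descBd i J) (fun x => norm_descBd_le_pi i J x) z κ
  rwa [liftBd_descBd i (fun x j => apply_add_period_of_isPeriodic hJ x j)] at h

/-! ## §2 `RegularAtHPer` from invertibility on the box -/

/-- ★★ **`RegularAtHPer` FROM INVERTIBILITY ON THE BOX.**  If `Δ_knit = deltaAOf η o U₀` is (the restriction of) a real-linear map, preserves
`E_𝔤^per(P₀)`, and a real-linear `K` on the member's box bond functions with `K(A♭) = (Δ_knit A)♭` for periodic Hermitian `A` is INJECTIVE, then `Δ_knit` is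
an invertible operator of `E_𝔤^per(P₀)`. [cite: Balaban1985BackgroundPropagators, (3.27) p.395, Thm 3.3 p.399; Balaban1985RegularSpaces, (1.58) p.86, p.77] -/
theorem regularAtHPer_of_injective_box [FiniteDimensional ℝ 𝔸] {η : ℝ} {o : OpsZd (d + 1) 𝔸}
    {U₀ : LSite (d + 1) → Fin (d + 1) → 𝔸ˣ} (hlin : LinearOnDomAt η o (Set.univ : Set (LSite (d + 1))) U₀)
    (hpres : PerPreservingAt η o ((PV d ℓ i.m i.K hd hL).sitesPerDir 0) U₀) (K : (FBondY i → 𝔸) → (FBondY i → 𝔸))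
    (hK : ∀ A ∈ domSubHPer (d := d + 1) (𝔸 := 𝔸) ((PV d ℓ i.m i.K hd hL).sitesPerDir 0), K (descBd i A) = descBd i (deltaAOf η o U₀ A))
    (hKinj : ∀ a, K a = 0 → a = 0) :
    RegularAtHPer η o ((PV d ℓ i.m i.K hd hL).sitesPerDir 0) U₀ := by
  haveI : NeZero ((PV d ℓ i.m i.K hd hL).sitesPerDir 0) := ⟨(PV d ℓ i.m i.K hd hL).sitesPerDir_ne_zero 0⟩
  haveI := finiteDimensional_domSubHPer (d := d + 1) (𝔸 := 𝔸) ((PV d ℓ i.m i.K hd hL).sitesPerDir 0)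
  obtain ⟨T, hT⟩ := hlin
  have hval : ∀ A : domSubHPer (d := d + 1) (𝔸 := 𝔸) ((PV d ℓ i.m i.K hd hL).sitesPerDir 0),
      T A ∈ domSubHPer (d := d + 1) (𝔸 := 𝔸) ((PV d ℓ i.m i.K hd hL).sitesPerDir 0) := by
    intro A
    rw [hT A (mem_domSub_univ _)]
    exact hpres A A.2
  let Φ : domSubHPer (d := d + 1) (𝔸 := 𝔸) ((PV d ℓ i.m i.K hd hL).sitesPerDir 0) →ₗ[ℝ]
      domSubHPer (d := d + 1) (𝔸 := 𝔸) ((PV d ℓ i.m i.K hd hL).sitesPerDir 0) :=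
    { toFun := fun A => ⟨T A, hval A⟩
      map_add' := fun A B => by
        apply Subtype.ext
        simp only [Submodule.coe_add, map_add]
      map_smul' := fun c A => by
        apply Subtype.ext
        simp only [Submodule.coe_smul, map_smul, RingHom.id_apply] }
  have hΦ : ∀ A : domSubHPer (d := d + 1) (𝔸 := 𝔸) ((PV d ℓ i.m i.K hd hL).sitesPerDir 0),
      (Φ A : LSite (d + 1) → Fin (d + 1) → 𝔸) = deltaAOf η o U₀ A := fun A => hT A (mem_domSub_univ _)
  have hinj : Function.Injective Φ := by
    rw [← LinearMap.ker_eq_bot, LinearMap.ker_eq_bot']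
    intro A hA
    have hzero : deltaAOf η o U₀ A = 0 := by
      rw [← hΦ A, hA, Submodule.coe_zero]
    have hKA : K (descBd i (A : LSite (d + 1) → Fin (d + 1) → 𝔸)) = 0 := by
      rw [hK A A.2, hzero]; rfl
    have hA0 : descBd i (A : LSite (d + 1) → Fin (d + 1) → 𝔸) = 0 := hKinj _ hKA
    have hper : IsPeriodic ((PV d ℓ i.m i.K hd hL).sitesPerDir 0) (A : LSite (d + 1) → Fin (d + 1) → 𝔸) := ((mem_domSubHPer_iff _ _).1 A.2).1
    apply Subtype.ext
    rw [Submodule.coe_zero, ← liftBd_descBd i (fun x j => apply_add_period_of_isPeriodic hper x j), hA0, liftBd_zero]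
  exact ⟨Φ, hΦ, hinj, LinearMap.injective_iff_surjective.1 hinj⟩

/-! ## §3 The assembled junction: the three global entries for `G_𝔤^per` -/

/-- ★★★ **THE NEUMANN JUNCTION, ASSEMBLED.**  At a constant-level member with `c_f = L^{n+1}` and knit spacing `η > 0`, for a letter record `o` whose
`Δ_knit = deltaAOf η o U₀` is real-linear and preserves `E_𝔤^per(P₀)` at the periodic background `U₀`, for def-Y's `Δ_a(U) = deltaAY i parS parB Gp U`,
`U = bgY i U₀`, invertible with the three (3.47)_{γ=−3} members at `B₀`, and under THE JUNCTION CLOSENESS `|Δ_a(U)a − (c_fη)²·(Δ_knit a♯)♭|₍₋₃₎ ≤ ε|a|₍₋₁₎`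
with `0 ≤ ε`, `2εB₀ ≤ 1` (OUR READING): `RegularAtHPer η o P₀ U₀`, and for every periodic Hermitian `J` the three global entries of [4] Thm 3.3 ∕ [B8]
(1.59) lines 1, 2, 4 hold for `G_𝔤^per J = gopZdHPer η o P₀ U₀ J` in the knit's currency with constant `2B₀`.
[cite: Balaban1985BackgroundPropagators, Thm 3.3 p.399, (3.47) p.398, (3.26)–(3.27) p.395; Balaban1985RegularSpaces, (1.58)–(1.59) p.86, p.77 («Ω_j = T_η»)] -/
theorem gopZdHPer_three_members [FiniteDimensional ℝ 𝔸] (hlev : ∀ z : SiteY i, levY i z = n)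
    (hcf : i.cf = (((ℓ + 1 : ℕ) : ℝ)) ^ (n + 1)) {η : ℝ} (hη : 0 < η) {o : OpsZd (d + 1) 𝔸}
    {U₀ : LSite (d + 1) → Fin (d + 1) → 𝔸ˣ} (hU₀per : IsPeriodic ((PV d ℓ i.m i.K hd hL).sitesPerDir 0) U₀)
    (hlin : LinearOnDomAt η o (Set.univ : Set (LSite (d + 1))) U₀) (hpres : PerPreservingAt η o ((PV d ℓ i.m i.K hd hL).sitesPerDir 0) U₀)
    (parS : SiteParY 𝔸 i) (parB : BondParY 𝔸 i) (Gp : SiteOpY 𝔸 i) (hΔ : IsUnit (deltaAY i parS parB Gp (bgY i U₀))) {B₀ ε : ℝ}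
    (hB₀ : 0 ≤ B₀) (hε : 0 ≤ ε) (hεB : 2 * ε * B₀ ≤ 1)
    (hG0 : ∀ F, wNormBY i (-1) (GAY i parS parB Gp (bgY i U₀) F) ≤ B₀ * wNormBY i (-3) F)
    (hG1 : ∀ F ν, wNormBY i (-2) (cdB i (bgY i U₀) ν (GAY i parS parB Gp (bgY i U₀) F)) ≤ B₀ * wNormBY i (-3) F)
    (hG3 : ∀ F, wNormBY i (-3) (lapB i (bgY i U₀) (GAY i parS parB Gp (bgY i U₀) F)) ≤ B₀ * wNormBY i (-3) F)
    (hE : ∀ a : FBondY i → 𝔸, wNormBY i (-3) (deltaAY i parS parB Gp (bgY i U₀) a - ((i.cf * η) ^ 2 : ℝ) • descBd i (deltaAOf η o U₀ (liftBd i a)))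
      ≤ ε * wNormBY i (-1) a) :
    RegularAtHPer η o ((PV d ℓ i.m i.K hd hL).sitesPerDir 0) U₀ ∧
      ∀ J ∈ domSubHPer (d := d + 1) (𝔸 := 𝔸) ((PV d ℓ i.m i.K hd hL).sitesPerDir 0),
        msup (ℓ + 1) n η (-(1 : ℝ)) (fun _ (_ : LSite (d + 1) × Fin (d + 1)) => True)
            (fun b => gopZdHPer η o ((PV d ℓ i.m i.K hd hL).sitesPerDir 0) U₀ J b.1 b.2) ≤
          2 * B₀ * bondNorm (ℓ + 1) n η (-(3 : ℝ)) (fun _ => (Set.univ : Set (LSite (d + 1)))) J ∧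
        msup (ℓ + 1) n η (-(2 : ℝ)) (fun _ (_ : Fin (d + 1) × Fin (d + 1) × LSite (d + 1)) => True)
            (fun t => covDerivFwd η U₀ t.1 (fun z => gopZdHPer η o ((PV d ℓ i.m i.K hd hL).sitesPerDir 0) U₀ J z t.2.1) t.2.2) ≤
          2 * B₀ * bondNorm (ℓ + 1) n η (-(3 : ℝ)) (fun _ => (Set.univ : Set (LSite (d + 1)))) J ∧
        bondNorm (ℓ + 1) n η (-(3 : ℝ)) (fun _ => (Set.univ : Set (LSite (d + 1))))
            (fun x μ => covLap η U₀ (fun z => gopZdHPer η o ((PV d ℓ i.m i.K hd hL).sitesPerDir 0) U₀ J z μ) x) ≤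
          2 * B₀ * bondNorm (ℓ + 1) n η (-(3 : ℝ)) (fun _ => (Set.univ : Set (LSite (d + 1)))) J := by
  haveI : NeZero ((PV d ℓ i.m i.K hd hL).sitesPerDir 0) := ⟨(PV d ℓ i.m i.K hd hL).sitesPerDir_ne_zero 0⟩
  set P₀ := (PV d ℓ i.m i.K hd hL).sitesPerDir 0 with hP₀
  set cr : ℝ := (i.cf * η) ^ 2 with hcr
  have hL1 : 1 ≤ ℓ + 1 := Nat.le_add_left 1 ℓ
  have hLpos : (0 : ℝ) < ((ℓ + 1 : ℕ) : ℝ) := by positivity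
  have hcf0 : 0 < i.cf := by rw [hcf]; exact pow_pos hLpos _
  have hx : 0 < i.cf * η := mul_pos hcf0 hη
  have hcr0 : 0 < cr := pow_pos hx 2
  have hη0 : η ≠ 0 := hη.ne'
  have hU₀sh : ∀ μ : Fin (d + 1), shiftCfg (((P₀ : ℕ) : ℤ) • e μ) U₀ = U₀ := fun μ => shiftCfg_eq_of_isPeriodic hU₀per μ
  -- the real-linear box conjugate `K a = (Δ_knit a♯)♭` and the perturbation `E = Δ_a(U) − c·K`
  obtain ⟨T, hT⟩ := hlin
  let K : Module.End ℝ (FBondY i → 𝔸) :=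
    { toFun := fun a => descBd i (T (liftBd i a))
      map_add' := fun a b => by
        have : liftBd i (a + b) = liftBd i a + liftBd i b := rfl
        rw [this, map_add]; rfl
      map_smul' := fun r a => by
        have : liftBd i (r • a) = r • liftBd i a := rfl
        rw [this, map_smul]; rfl }
  have hKapply : ∀ a, K a = descBd i (deltaAOf η o U₀ (liftBd i a)) := fun a => by
    show descBd i (T (liftBd i a)) = _
    rw [hT _ (mem_domSub_univ _)]
  set TY : Module.End ℝ (FBondY i → 𝔸) := (deltaAY i parS parB Gp (bgY i U₀)).restrictScalars ℝ with hTY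
  set E : Module.End ℝ (FBondY i → 𝔸) := TY - cr • K with hEdef
  have hEapply : ∀ a, E a = deltaAY i parS parB Gp (bgY i U₀) a - cr • descBd i (deltaAOf η o U₀ (liftBd i a)) := fun a => by
    rw [hEdef, LinearMap.sub_apply, LinearMap.smul_apply, hKapply]
    rfl
  have hE' : ∀ a, wNormBY i (-3) (E a) ≤ ε * wNormBY i (-1) a := fun a => by rw [hEapply]; exact hE a
  have hsub : TY - E = cr • K := by rw [hEdef, sub_sub_cancel]
  -- the Neumann core (file 7b)
  obtain ⟨hU, h0, h1, h3⟩ :=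
    GAY_sub_three_members_real i hlev parS parB Gp (bgY i U₀) hΔ hB₀ hε hεB hG0 hG1 hG3 E hE'
  change IsUnit (TY - E) at hU
  change ∀ F, wNormBY i (-1) (Ring.inverse (TY - E) F) ≤ 2 * B₀ * wNormBY i (-3) F at h0
  change ∀ F ν, wNormBY i (-2) (cdB i (bgY i U₀) ν (Ring.inverse (TY - E) F)) ≤ 2 * B₀ * wNormBY i (-3) F at h1
  change ∀ F, wNormBY i (-3) (lapB i (bgY i U₀) (Ring.inverse (TY - E) F)) ≤ 2 * B₀ * wNormBY i (-3) F at h3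
  have hinv : ∀ v, Ring.inverse (TY - E) ((TY - E) v) = v := fun v => by
    have h2 := congrArg (fun S : Module.End ℝ (FBondY i → 𝔸) => S v) (Ring.inverse_mul_cancel _ hU)
    simpa only [Module.End.mul_apply, Module.End.one_apply] using h2
  -- `RegularAtHPer`
  have hKinj : ∀ a, K a = 0 → a = 0 := fun a ha => by
    have h1' : (TY - E) a = 0 := by rw [hsub, LinearMap.smul_apply, ha, smul_zero]
    have h2 := hinv a
    rw [h1', map_zero] at h2
    exact h2.symm
  have hreg : RegularAtHPer η o P₀ U₀ :=
    regularAtHPer_of_injective_box i ⟨T, hT⟩ hpres K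
      (fun A hA => by
        rw [hKapply, liftBd_descBd i (fun x j => apply_add_period_of_isPeriodic ((mem_domSubHPer_iff _ _).1 hA).1 x j)])
      hKinj
  refine ⟨hreg, fun J hJ => ?_⟩
  -- the solution `A'` of `Δ_knit A' = J` in the carrier, and `A'♭ = G₂(c·J♭)`
  obtain ⟨Φ, hΦ, hbij⟩ := hreg
  obtain ⟨A', hA'⟩ := hbij.2 ⟨J, hJ⟩
  have hA'per : IsPeriodic P₀ (A' : LSite (d + 1) → Fin (d + 1) → 𝔸) := ((mem_domSubHPer_iff _ _).1 A'.2).1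
  have hA'sh : ∀ (x : LSite (d + 1)) (j : Fin (d + 1)),
      (A' : LSite (d + 1) → Fin (d + 1) → 𝔸) (x + ((P₀ : ℕ) : ℤ) • e j) = (A' : LSite (d + 1) → Fin (d + 1) → 𝔸) x :=
    fun x j => apply_add_period_of_isPeriodic hA'per x j
  have hJper : IsPeriodic P₀ J := ((mem_domSubHPer_iff _ _).1 hJ).1
  have hΔA' : deltaAOf η o U₀ A' = J := by
    have h := congrArg Subtype.val hA'
    rw [hΦ A'] at h
    exact h
  have hG : gopZdHPer η o P₀ U₀ J = A' :=
    gopZdHPer_apply_eq_of_regularAtHPer η o P₀ U₀ ⟨Φ, hΦ, hbij⟩ A'.2 fun y τ => by rw [hΔA']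
  have hsol : descBd i (A' : LSite (d + 1) → Fin (d + 1) → 𝔸) = Ring.inverse (TY - E) (cr • descBd i J) := by
    have hKA : (TY - E) (descBd i (A' : LSite (d + 1) → Fin (d + 1) → 𝔸)) = cr • descBd i J := by
      rw [hsub, LinearMap.smul_apply, hKapply, liftBd_descBd i hA'sh, hΔA']
    have h2 := hinv (descBd i (A' : LSite (d + 1) → Fin (d + 1) → 𝔸))
    rw [hKA] at h2
    exact h2.symm
  -- weights and units
  set w₁ := weight (ℓ + 1) |i.cf|⁻¹ (-1) n with hw₁
  set w₂ := weight (ℓ + 1) |i.cf|⁻¹ (-2) n with hw₂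
  set w₃ := weight (ℓ + 1) |i.cf|⁻¹ (-3) n with hw₃
  set k₁ := weight (ℓ + 1) η (-1) n with hk₁
  set k₂ := weight (ℓ + 1) η (-2) n with hk₂
  set k₃ := weight (ℓ + 1) η (-3) n with hk₃
  have hw₁p : 0 < w₁ := weight_level_pos i _ n
  have hw₂p : 0 < w₂ := weight_level_pos i _ n
  have hw₃p : 0 < w₃ := weight_level_pos i _ n
  have hk₁p : 0 < k₁ := B8ScaledSupNorm.weight_pos hL1 hη _ n
  have hk₂p : 0 < k₂ := B8ScaledSupNorm.weight_pos hL1 hη _ n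
  have hk₃p : 0 < k₃ := B8ScaledSupNorm.weight_pos hL1 hη _ n
  have hxne : i.cf * η ≠ 0 := hx.ne'
  have hk₁ne : k₁ ≠ 0 := hk₁p.ne'
  have hk₂ne : k₂ ≠ 0 := hk₂p.ne'
  have hk₃ne : k₃ ≠ 0 := hk₃p.ne'
  have hr₁ : (i.cf * η) ^ (-1 : ℝ) = (i.cf * η)⁻¹ := by
    rw [show (-1 : ℝ) = -((1 : ℕ) : ℝ) by norm_num, Real.rpow_neg hx.le, Real.rpow_natCast, pow_one]
  have hr₂ : (i.cf * η) ^ (-2 : ℝ) = ((i.cf * η) ^ 2)⁻¹ := by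
    rw [show (-2 : ℝ) = -((2 : ℕ) : ℝ) by norm_num, Real.rpow_neg hx.le, Real.rpow_natCast]
  have hr₃ : (i.cf * η) ^ (-3 : ℝ) = ((i.cf * η) ^ 3)⁻¹ := by
    rw [show (-3 : ℝ) = -((3 : ℕ) : ℝ) by norm_num, Real.rpow_neg hx.le, Real.rpow_natCast]
  have hu₁ : w₁ = (i.cf * η)⁻¹ * k₁ := by rw [hw₁, weight_defY_eq_mul_weight_knit i hcf hη, hr₁]
  have hu₂ : w₂ = ((i.cf * η) ^ 2)⁻¹ * k₂ := by rw [hw₂, weight_defY_eq_mul_weight_knit i hcf hη, hr₂]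
  have hu₃ : w₃ = ((i.cf * η) ^ 3)⁻¹ * k₃ := by rw [hw₃, weight_defY_eq_mul_weight_knit i hcf hη, hr₃]
  -- the source in def-Y currency: `|c·J♭|₍₋₃₎ ≤ c·w₃·‖J♭‖` and `k₃‖J♭‖ ≤ |J|₍₋₃₎`
  set NJ := bondNorm (ℓ + 1) n η (-(3 : ℝ)) (fun _ => (Set.univ : Set (LSite (d + 1)))) J with hNJ
  have hJbd : ∀ (z : LSite (d + 1)) (κ : Fin (d + 1)), ‖J z κ‖ ≤ ‖descBd i J‖ := fun z κ => norm_apply_le_pi_descBd i hJper z κ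
  have hNJ0 : 0 ≤ NJ := B8ScaledSupNorm.msup_nonneg (ℓ + 1) n hη.le _ _ _
  have hJsup : k₃ * ‖descBd i J‖ ≤ NJ := by
    rw [mul_comm, ← le_div_iff₀ hk₃p]
    refine (pi_norm_le_iff_of_nonneg (div_nonneg hNJ0 hk₃p.le)).2 fun b => ?_
    rw [le_div_iff₀ hk₃p, mul_comm, descBd_apply]
    exact weight_top_mul_norm_le_bondNorm_univ hL1 hη (by norm_num) rfl hJbd _ _
  have hsrc : wNormBY i (-3) (cr • descBd i J) ≤ cr * (w₃ * ‖descBd i J‖) := by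
    rw [wNormBY_real_smul i hlev, abs_of_pos hcr0]
    exact mul_le_mul_of_nonneg_left (wNormBY_descBd_le i hlev (norm_nonneg _) hJbd) hcr0.le
  refine ⟨?_, ?_, ?_⟩
  · -- n = 0 : `|GJ|₍₋₁₎ ≤ 2B₀|J|₍₋₃₎`
    have hpt : ∀ b : LSite (d + 1) × Fin (d + 1), ‖gopZdHPer η o P₀ U₀ J b.1 b.2‖ ≤ w₁⁻¹ * (2 * B₀ * (cr * (w₃ * ‖descBd i J‖))) := by
      intro b
      rw [hG]
      have h := (h0 (cr • descBd i J)).trans (mul_le_mul_of_nonneg_left hsrc (by positivity))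
      rw [← hsol] at h
      have h' := norm_liftBd_le_of_wNormBY_le i hlev h b.1 b.2
      rwa [liftBd_descBd i hA'sh] at h'
    refine (msup_le_weight_top_mul hL1 hη (by norm_num) (by positivity) hpt).trans ?_
    have hk : weight (ℓ + 1) η (-(1 : ℝ)) n = k₁ := rfl
    have : weight (ℓ + 1) η (-(1 : ℝ)) n * (w₁⁻¹ * (2 * B₀ * (cr * (w₃ * ‖descBd i J‖)))) = 2 * B₀ * (k₃ * ‖descBd i J‖) := by
      rw [hk, hu₁, hu₃, hcr]; field_simp
    rw [this]
    exact mul_le_mul_of_nonneg_left hJsup (by positivity)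
  · -- n = 1 : `|∇_{U₀}GJ|₍₋₂₎ ≤ 2B₀|J|₍₋₃₎`
    have hpt : ∀ t : Fin (d + 1) × Fin (d + 1) × LSite (d + 1),
        ‖covDerivFwd η U₀ t.1 (fun z => gopZdHPer η o P₀ U₀ J z t.2.1) t.2.2‖ ≤ (i.cf * η)⁻¹ * (w₂⁻¹ * (2 * B₀ * (cr * (w₃ * ‖descBd i J‖)))) := by
      intro t
      rw [hG]
      have h := (h1 (cr • descBd i J) t.1).trans (mul_le_mul_of_nonneg_left hsrc (by positivity))
      rw [← hsol] at h
      have h' := B9B8KnitNormsTransfer.norm_covDerivFwd_le_of_wNormBY i η hlev hη0 hU₀sh hA'sh t.1 h t.2.2 t.2.1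
      rw [norm_smul, Complex.norm_real, Real.norm_eq_abs, abs_of_pos hx] at h'
      rw [← div_eq_inv_mul, le_div_iff₀' hx]
      exact h'
    refine (msup_le_weight_top_mul hL1 hη (by norm_num) (by positivity) hpt).trans ?_
    have hk : weight (ℓ + 1) η (-(2 : ℝ)) n = k₂ := rfl
    have : weight (ℓ + 1) η (-(2 : ℝ)) n * ((i.cf * η)⁻¹ * (w₂⁻¹ * (2 * B₀ * (cr * (w₃ * ‖descBd i J‖))))) =
        2 * B₀ * (k₃ * ‖descBd i J‖) := by
      rw [hk, hu₂, hu₃, hcr]; field_simp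
    rw [this]
    exact mul_le_mul_of_nonneg_left hJsup (by positivity)
  · -- n = 3 : `|Δ_{U₀}GJ|₍₋₃₎ ≤ 2B₀|J|₍₋₃₎`
    have hpt : ∀ (x : LSite (d + 1)) (μ : Fin (d + 1)),
        ‖covLap η U₀ (fun z => gopZdHPer η o P₀ U₀ J z μ) x‖ ≤ ((i.cf * η) ^ 2)⁻¹ * (w₃⁻¹ * (2 * B₀ * (cr * (w₃ * ‖descBd i J‖)))) := by
      intro x μ
      rw [hG]
      have h := (h3 (cr • descBd i J)).trans (mul_le_mul_of_nonneg_left hsrc (by positivity))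
      rw [← hsol] at h
      have h' := B9B8KnitNormsTransfer.norm_covLap_le_of_wNormBY i η hlev hη0 hU₀sh hA'sh h x μ
      rw [norm_smul, norm_pow, Complex.norm_real, Real.norm_eq_abs, abs_of_pos hx] at h'
      rw [← div_eq_inv_mul, le_div_iff₀' (pow_pos hx 2)]
      exact h'
    refine (bondNorm_le_weight_top_mul hL1 hη (by norm_num) (by positivity) hpt).trans ?_
    have hk : weight (ℓ + 1) η (-(3 : ℝ)) n = k₃ := rfl
    have hw₃ne : w₃ ≠ 0 := hw₃p.ne'
    have : weight (ℓ + 1) η (-(3 : ℝ)) n * (((i.cf * η) ^ 2)⁻¹ * (w₃⁻¹ * (2 * B₀ * (cr * (w₃ * ‖descBd i J‖))))) =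
        2 * B₀ * (k₃ * ‖descBd i J‖) := by
      rw [hk, hcr]; field_simp
    rw [this]
    exact mul_le_mul_of_nonneg_left hJsup (by positivity)

end Literature.MathematicalPhysics.QuantumFieldTheory.Balaban1983to89.B9B8KnitNeumannJunction
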